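import Summits.BirchSwinnertonDyer.BirchSwinnertonDyer.Theorems.CyclotomicUntwistNineHondaCongruence
import Summits.BirchSwinnertonDyer.BirchSwinnertonDyer.Theorems.CyclotomicUntwistNineGoodModelUnique
import HarnessLib

/-!
# The descended Frobenius matrix from ONE transfer datum: the `ω`-column `φ[ω] ≡ c[ω] + d[η]`
# (reduction of the print input `isDescendedFrobeniusMatrix_exists` to the position of `[η_W]` in the `ω`-plane)

Cell `pub/bsd-wall`, D-0145 line `route-BirchSwinnertonDyer-CyclotomicUntwist`, lead seat `bsd-line-cycu-p1` (gen 6),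
lane «HONDA OVER `𝓞_{ℚ₃(ζ₉)}`» (part 3; parts 1–2 = `CyclotomicUntwistNineHondaEstimate`, `…NineHondaCongruence`).
Helper toward the print input `WeierstrassCurve.isDescendedFrobeniusMatrix_exists` of the K-SEP child C2 =
stmt-BirchSwinnertonDyer-27549 (cruxes K1 `PSRankOneLowerHalfAtThree` = 21580 / K2 = 21581).

With `φ := (z ↦ z³)^* = expand 3` on `ℚ₃(ζ₉)⟦z⟧` modulo bounded denominators, part 2 proved the `ω`-ROW of the
descended Frobenius for every good model `𝓜` over `𝓞 = 𝓞_{ℚ₃(ζ₉)}`: `φ²[ω] ≡ a·φ[ω] − 3·[ω]` (`a` the special-fibre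
trace). Here we show that ONE more datum — the `ω`-COLUMN `φ[ω] ≡ c·[ω] + d·[η]` in the Néron basis with `c, d ∈ ℚ₃`,
`d ≠ 0` (equivalently: the second Néron class lies in the `ω`-plane, `[η] = d⁻¹(φ[ω] − c[ω])`) — determines EVERYTHING
the definition `WeierstrassCurve.IsDescendedFrobeniusMatrix` asks for, by pure algebra:

* `isPowerMapMatrix_comp` — power maps compose: `IsPowerMapMatrix 𝓜 b N → IsPowerMapMatrix 𝓜 a N' →
  IsPowerMapMatrix 𝓜 (a·b) (N'·N)` (so `q = 9, 27` follow from `q = 3`);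
* `isPowerMapMatrix_three_of_omegaColumn` — from the `ω`-column datum and Honda's relation:
  `IsPowerMapMatrix 𝓜 3 M` with **`M = !![c, ((a − c)c − 3)/d; d, a − c] ∈ M₂(ℚ₃)`**, `det M = 3`, `tr M = a`, `M₁₀ = d`;
  hence `IsPowerMapMatrix 𝓜 9 (M²)`, `IsPowerMapMatrix 𝓜 27 (M³)` (`isPowerMapMatrix_nine_twentySeven_of_omegaColumn`);
* `classesIndependent_of_omegaColumn` — `ClassesIndependent 𝓜` from the `ω`-column datum and the independence of
  `([ω], φ[ω])` modulo bounded denominators;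
* `isDescendedFrobeniusMatrix_of_omegaColumn` — if the SAME `(c, d)` serves every good model of `W` (the classes are
  `W`-intrinsic) and `([ω], φ[ω])` is independent on every good model, then `W.IsDescendedFrobeniusMatrix M` with
  `tr M = a` (model-independence of `a`: `NineIntegers.specialFibreTrace_eq_of_nineGoodModel_of_residueMap`);
* `isDescendedFrobeniusMatrix_exists_of_omegaColumnTransfer` — **the named fact `isDescendedFrobeniusMatrix_exists`
  FOLLOWS from the single transfer statement «for `W` with a supersingular good model over `𝓞`: `∃ c d ∈ ℚ₃`, `d ≠ 0`,
  with `φ[ω_W] ≡ c[ω_W] + d[η_W]` and `([ω_W], φ[ω_W])` independent modulo bounded denominators on every good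
  model»** — the Berthelot–Ogus/Katz content (position of the second-kind class, Katz 1981 Thm. 5.7.2; independence =
  rank 2, Thm. 5.3.3) isolated from the Frobenius/trace/determinant content, which is now kernel.

THEOREMS ONLY (hypotheses are explicit binders; no `def`, no named fact, no `sorry`); BSD is not proved by this file
and no crux is.

References: N. M. Katz, LNM 868 (1981) Thm. 5.1.4, 5.3.3, 5.7.2 [Katz1981CrystallineDieudonne]; P. Berthelot, A. Ogus,
Invent. Math. 72 (1983) (2.4), (3.14) [BerthelotOgus1983]; T. Honda, J. Math. Soc. Japan 22 (1970) Thm. 9 [Honda1970].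
-/

-- single-conjunct summit: `Summit.BirchSwinnertonDyer.BirchSwinnertonDyer.…` repeats the name by design
set_option linter.dupNamespace false
set_option autoImplicit false

noncomputable section

open scoped Classical
open PowerSeries IsCyclotomicExtension Literature.NumberTheory.EllipticCurves.DescendedFrobenius
  Summit.BirchSwinnertonDyer.BirchSwinnertonDyer.Theorems.NineIntegers
  Summit.BirchSwinnertonDyer.BirchSwinnertonDyer.Theorems.DescendedFrobeniusTransfer
  Summit.BirchSwinnertonDyer.BirchSwinnertonDyer.Theorems.NineHonda

namespace Summit.BirchSwinnertonDyer.BirchSwinnertonDyer.Theorems.NineDescendedFrobeniusOfOmegaColumn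

variable {W : WeierstrassCurve ℚ}

/-! ### §1 Power maps compose -/

/-- **Power maps compose**: if `z ↦ z^b` has matrix `N` and `z ↦ z^a` has matrix `N'` on `([ω], [η])` modulo bounded
denominators, then `z ↦ z^{ab}` has matrix `N'·N` (`expand a ∘ expand b = expand (a·b)`, `expand` is `ℚ₃(ζ₉)`-linear and
preserves bounded denominators). [cite: Katz1981CrystallineDieudonne, Thm. 5.1.4] -/
theorem isPowerMapMatrix_comp (𝓜 : W.NineGoodModel) {a b : ℕ} (ha : a ≠ 0) (hb : b ≠ 0)
    {N N' : Matrix (Fin 2) (Fin 2) KNine} (hN : 𝓜.IsPowerMapMatrix b hb N) (hN' : 𝓜.IsPowerMapMatrix a ha N') :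
    𝓜.IsPowerMapMatrix (a * b) (Nat.mul_ne_zero ha hb) (N' * N) := by
  set Ω := 𝓜.classOmega with hΩ
  set H := 𝓜.classEta with hH
  obtain ⟨hN1, hN2⟩ := hN
  obtain ⟨hN1', hN2'⟩ := hN'
  have e1 : expand (a * b) (Nat.mul_ne_zero ha hb) Ω = expand a ha (expand b hb Ω) := expand_mul a ha b hb Ω
  have e2 : expand (a * b) (Nat.mul_ne_zero ha hb) H = expand a ha (expand b hb H) := expand_mul a ha b hb H
  constructor
  · -- image of `[ω]`
    have h1 := hbd_expand a ha hN1
    rw [map_sub, map_sub, expand_smul, expand_smul] at h1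
    have h := (h1.add (hbd_smul (N 0 0) hN1')).add (hbd_smul (N 1 0) hN2')
    have e : expand a ha (expand b hb Ω) - N 0 0 • expand a ha Ω - N 1 0 • expand a ha H +
          N 0 0 • (expand a ha Ω - N' 0 0 • Ω - N' 1 0 • H) + N 1 0 • (expand a ha H - N' 0 1 • Ω - N' 1 1 • H) =
        expand (a * b) (Nat.mul_ne_zero ha hb) Ω - (N' * N) 0 0 • Ω - (N' * N) 1 0 • H := by
      rw [e1, Matrix.mul_apply, Matrix.mul_apply, Fin.sum_univ_two, Fin.sum_univ_two]
      simp only [smul_sub, add_smul, mul_smul]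
      abel_nf
      simp only [smul_smul, mul_comm (N 0 0), mul_comm (N 1 0)]
      abel
    rwa [e] at h
  · -- image of `[η]`
    have h1 := hbd_expand a ha hN2
    rw [map_sub, map_sub, expand_smul, expand_smul] at h1
    have h := (h1.add (hbd_smul (N 0 1) hN1')).add (hbd_smul (N 1 1) hN2')
    have e : expand a ha (expand b hb H) - N 0 1 • expand a ha Ω - N 1 1 • expand a ha H +
          N 0 1 • (expand a ha Ω - N' 0 0 • Ω - N' 1 0 • H) + N 1 1 • (expand a ha H - N' 0 1 • Ω - N' 1 1 • H) =
        expand (a * b) (Nat.mul_ne_zero ha hb) H - (N' * N) 0 1 • Ω - (N' * N) 1 1 • H := by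
      rw [e2, Matrix.mul_apply, Matrix.mul_apply, Fin.sum_univ_two, Fin.sum_univ_two]
      simp only [smul_sub, add_smul, mul_smul]
      abel_nf
      simp only [smul_smul, mul_comm (N 0 1), mul_comm (N 1 1)]
      abel
    rwa [e] at h

/-- `IsPowerMapMatrix` for `9 = 3·3` and `27 = 3·9` from the one for `3`: matrices `N·N` and `N·(N·N)`.
[cite: Katz1981CrystallineDieudonne, Thm. 5.1.4] -/
theorem isPowerMapMatrix_nine_twentySeven_of_three (𝓜 : W.NineGoodModel) {N : Matrix (Fin 2) (Fin 2) KNine}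
    (hN : 𝓜.IsPowerMapMatrix 3 (by norm_num) N) :
    𝓜.IsPowerMapMatrix 9 (by norm_num) (N ^ 2) ∧ 𝓜.IsPowerMapMatrix 27 (by norm_num) (N ^ 3) := by
  have h9 : 𝓜.IsPowerMapMatrix (3 * 3) (by norm_num) (N * N) := isPowerMapMatrix_comp 𝓜 _ _ hN hN
  have h27 : 𝓜.IsPowerMapMatrix (3 * (3 * 3)) (by norm_num) (N * (N * N)) := isPowerMapMatrix_comp 𝓜 _ _ h9 hN
  refine ⟨?_, ?_⟩
  · rw [pow_two]; exact h9
  · rw [pow_succ', pow_two]; exact h27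

/-! ### §2 The `ω`-column datum `φ[ω] ≡ c[ω] + d[η]` determines the Frobenius matrix -/

/-- `C x * C x⁻¹ = 1` for `x ≠ 0`. [folklore] -/
theorem C_mul_C_inv {x : KNine} (hx : x ≠ 0) : (PowerSeries.C x : KNine⟦X⟧) * PowerSeries.C x⁻¹ = 1 := by
  rw [← map_mul, mul_inv_cancel₀ hx, map_one]

/-- **`IsPowerMapMatrix 𝓜 3 M` from the `ω`-column and Honda's relation.** If `φ[ω] ≡ c[ω] + d[η]` modulo bounded
denominators (`φ = expand 3`, `c, d ∈ ℚ₃`, `d ≠ 0`), then with `a = 𝓜.specialFibreTrace ρ` and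
`M = !![c, ((a − c)c − 3)/d; d, a − c]`: `IsPowerMapMatrix 𝓜 3 (M ⊗ ℚ₃(ζ₉))`. The `η`-column is forced by
`φ²[ω] ≡ aφ[ω] − 3[ω]` (`NineHonda.hbd_honda_classOmega`): `d·φ[η] ≡ ((a − c)c − 3)[ω] + d(a − c)[η]`.
[cite: Katz1981CrystallineDieudonne, Thm. 5.1.4 and (6.1.1)] [cite: Honda1970, Thm. 9] -/
theorem isPowerMapMatrix_three_of_omegaColumn (𝓜 : W.NineGoodModel) (ρ : ONine →+* ZMod 3) {c d : ℚ_[3]}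
    (hd : d ≠ 0)
    (hω : HasBoundedDenominators (expand 3 (by norm_num) 𝓜.classOmega -
      PowerSeries.C (algebraMap ℚ_[3] KNine c) * 𝓜.classOmega - PowerSeries.C (algebraMap ℚ_[3] KNine d) * 𝓜.classEta)) :
    𝓜.IsPowerMapMatrix 3 (by norm_num)
      ((!![c, (((𝓜.specialFibreTrace ρ : ℚ_[3]) - c) * c - 3) / d; d, (𝓜.specialFibreTrace ρ : ℚ_[3]) - c] :
        Matrix (Fin 2) (Fin 2) ℚ_[3]).map (algebraMap ℚ_[3] KNine)) := by
  set ι := algebraMap ℚ_[3] KNine with hι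
  set Ω := 𝓜.classOmega with hΩ
  set H := 𝓜.classEta with hH
  set a : ℚ_[3] := (𝓜.specialFibreTrace ρ : ℚ_[3]) with ha
  have hd' : ι d ≠ 0 := (map_ne_zero ι).mpr hd
  have haK : ((𝓜.specialFibreTrace ρ : ℤ) : KNine) = ι a := by rw [ha, map_intCast]
  -- Honda: `φ²Ω − a φΩ + 3Ω ∈ HBD`
  have R₂ := hbd_honda_classOmega 𝓜 ρ
  rw [haK, ← hΩ] at R₂
  have e33 : expand (3 ^ 2) (Literature.RingTheory.FormalGroups.prime_sq_ne_zero 3) Ω =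
      expand 3 (by norm_num) (expand 3 (by norm_num) Ω) :=
    (expand_expand (by norm_num) (by norm_num) (Literature.RingTheory.FormalGroups.prime_sq_ne_zero 3)
      (by norm_num) Ω).symm
  rw [e33] at R₂
  constructor
  · -- `ω`-column: literally the datum
    have e : expand 3 (by norm_num) Ω -
          (Matrix.map !![c, ((a - c) * c - 3) / d; d, a - c] ι) 0 0 • Ω -
          (Matrix.map !![c, ((a - c) * c - 3) / d; d, a - c] ι) 1 0 • H =
        expand 3 (by norm_num) Ω - PowerSeries.C (ι c) * Ω - PowerSeries.C (ι d) * H := by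
      simp only [Matrix.map_apply, Matrix.of_apply, Matrix.cons_val', Matrix.cons_val_zero, Matrix.cons_val_one,
        Matrix.empty_val', Matrix.cons_val_fin_one, smul_eq_C_mul]
    rw [e]; exact hω
  · -- `η`-column: `d·(φH − M₀₁Ω − M₁₁H) = −φ(hω) + R₂ + (a − c)·hω`
    have hφ := hbd_expand 3 (by norm_num) hω
    rw [map_sub, map_sub, map_mul, map_mul, expand_C, expand_C] at hφ
    have hsum := ((hφ.neg).add R₂).add (hbd_C_mul (ι (a - c)) hω)
    -- divide by `d`
    have hdiv := hbd_C_mul (ι d)⁻¹ hsum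
    have e : PowerSeries.C (ι d)⁻¹ *
        (-(expand 3 (by norm_num) (expand 3 (by norm_num) Ω) - PowerSeries.C (ι c) * expand 3 (by norm_num) Ω -
            PowerSeries.C (ι d) * expand 3 (by norm_num) H) +
          (expand 3 (by norm_num) (expand 3 (by norm_num) Ω) -
            PowerSeries.C (ι a) * expand 3 (by norm_num) Ω + 3 * Ω) +
          PowerSeries.C (ι (a - c)) * (expand 3 (by norm_num) Ω - PowerSeries.C (ι c) * Ω - PowerSeries.C (ι d) * H)) =
        expand 3 (by norm_num) H -
          (Matrix.map !![c, ((a - c) * c - 3) / d; d, a - c] ι) 0 1 • Ω -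
          (Matrix.map !![c, ((a - c) * c - 3) / d; d, a - c] ι) 1 1 • H := by
      simp only [Matrix.map_apply, Matrix.of_apply, Matrix.cons_val', Matrix.cons_val_zero, Matrix.cons_val_one,
        Matrix.empty_val', Matrix.cons_val_fin_one, smul_eq_C_mul, map_sub, map_mul, map_inv₀, map_ofNat,
        div_eq_mul_inv]
      linear_combination (expand 3 (by norm_num) H - (PowerSeries.C (ι a) - PowerSeries.C (ι c)) * H) *
        C_mul_C_inv hd'
    rwa [e] at hdiv

/-- **`det M = 3`, `tr M = a`, `M₁₀ = d`** for `M = !![c, ((a − c)c − 3)/d; d, a − c]` (`d ≠ 0`). [folklore] -/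
theorem det_trace_of_omegaColumn (a c d : ℚ_[3]) (hd : d ≠ 0) :
    (!![c, ((a - c) * c - 3) / d; d, a - c] : Matrix (Fin 2) (Fin 2) ℚ_[3]).det = 3 ∧
      (!![c, ((a - c) * c - 3) / d; d, a - c] : Matrix (Fin 2) (Fin 2) ℚ_[3]).trace = a ∧
      (!![c, ((a - c) * c - 3) / d; d, a - c] : Matrix (Fin 2) (Fin 2) ℚ_[3]) 1 0 = d := by
  refine ⟨?_, ?_, rfl⟩
  · rw [Matrix.det_fin_two_of]
    field_simp
    ring
  · rw [Matrix.trace_fin_two_of]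
    ring

/-- **`9` and `27`**: from the `ω`-column datum, `IsPowerMapMatrix 𝓜 9 (M²)` and `IsPowerMapMatrix 𝓜 27 (M³)` with
`M = !![c, ((a − c)c − 3)/d; d, a − c]` read in `ℚ₃(ζ₉)`. [cite: Katz1981CrystallineDieudonne, Thm. 5.1.4] -/
theorem isPowerMapMatrix_nine_twentySeven_of_omegaColumn (𝓜 : W.NineGoodModel) (ρ : ONine →+* ZMod 3)
    {c d : ℚ_[3]} (hd : d ≠ 0)
    (hω : HasBoundedDenominators (expand 3 (by norm_num) 𝓜.classOmega -
      PowerSeries.C (algebraMap ℚ_[3] KNine c) * 𝓜.classOmega - PowerSeries.C (algebraMap ℚ_[3] KNine d) * 𝓜.classEta)) :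
    𝓜.IsPowerMapMatrix 9 (by norm_num)
        (((!![c, (((𝓜.specialFibreTrace ρ : ℚ_[3]) - c) * c - 3) / d; d, (𝓜.specialFibreTrace ρ : ℚ_[3]) - c] :
          Matrix (Fin 2) (Fin 2) ℚ_[3]) ^ 2).map (algebraMap ℚ_[3] KNine)) ∧
      𝓜.IsPowerMapMatrix 27 (by norm_num)
        (((!![c, (((𝓜.specialFibreTrace ρ : ℚ_[3]) - c) * c - 3) / d; d, (𝓜.specialFibreTrace ρ : ℚ_[3]) - c] :
          Matrix (Fin 2) (Fin 2) ℚ_[3]) ^ 3).map (algebraMap ℚ_[3] KNine)) := by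
  have h3 := isPowerMapMatrix_three_of_omegaColumn 𝓜 ρ hd hω
  have h := isPowerMapMatrix_nine_twentySeven_of_three 𝓜 h3
  rw [← Matrix.map_pow, ← Matrix.map_pow] at h
  exact h

/-- **`ClassesIndependent 𝓜` from the `ω`-column datum and the independence of `([ω], φ[ω])`** modulo bounded
denominators: `x[ω] + y[η] ≡ 0` gives `d(x[ω] + y[η]) + y·hω = (dx − yc)[ω] + y·φ[ω] ≡ 0`, so `y = 0`, `x = 0`.
[cite: Katz1981CrystallineDieudonne, Thm. 5.3.3] -/
theorem classesIndependent_of_omegaColumn (𝓜 : W.NineGoodModel) {c d : ℚ_[3]} (hd : d ≠ 0)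
    (hω : HasBoundedDenominators (expand 3 (by norm_num) 𝓜.classOmega -
      PowerSeries.C (algebraMap ℚ_[3] KNine c) * 𝓜.classOmega - PowerSeries.C (algebraMap ℚ_[3] KNine d) * 𝓜.classEta))
    (hind : ∀ x y : KNine, HasBoundedDenominators (PowerSeries.C x * 𝓜.classOmega +
      PowerSeries.C y * expand 3 (by norm_num) 𝓜.classOmega) → x = 0 ∧ y = 0) :
    𝓜.ClassesIndependent := by
  set ι := algebraMap ℚ_[3] KNine with hι
  have hd' : ι d ≠ 0 := (map_ne_zero ι).mpr hd
  intro x y hxy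
  rw [smul_eq_C_mul, smul_eq_C_mul] at hxy
  have h := (hbd_C_mul (ι d) hxy).add (hbd_C_mul y hω)
  have e : PowerSeries.C (ι d) * (PowerSeries.C x * 𝓜.classOmega + PowerSeries.C y * 𝓜.classEta) +
        PowerSeries.C y * (expand 3 (by norm_num) 𝓜.classOmega - PowerSeries.C (ι c) * 𝓜.classOmega -
          PowerSeries.C (ι d) * 𝓜.classEta) =
      PowerSeries.C (ι d * x - y * ι c) * 𝓜.classOmega + PowerSeries.C y * expand 3 (by norm_num) 𝓜.classOmega := by
    simp only [map_sub, map_mul]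
    ring
  rw [e] at h
  obtain ⟨h1, h2⟩ := hind _ _ h
  refine ⟨?_, h2⟩
  rw [h2, zero_mul, sub_zero] at h1
  exact (mul_eq_zero.mp h1).resolve_left hd'

/-! ### §3 All good models: the named-fact shape -/

/-- A curve with a good model over `𝓞` is elliptic (`Δ_E` is a unit and `Δ_{C • W} = u⁻¹² Δ_W`). [cite: SilvermanAEC2009, VII.1] -/
theorem isElliptic_of_nineGoodModel (𝓜 : W.NineGoodModel) : W.IsElliptic := by
  refine ⟨isUnit_iff_ne_zero.mpr fun h0 => ?_⟩
  have hΔ : (𝓜.C • W.map (algebraMap ℚ KNine)).Δ = 0 := by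
    rw [WeierstrassCurve.variableChange_Δ, WeierstrassCurve.map_Δ, h0, map_zero, mul_zero]
  rw [𝓜.smul_eq, WeierstrassCurve.map_Δ] at hΔ
  have hu : IsUnit ((algebraMap ONine KNine) 𝓜.E.Δ) := 𝓜.isUnit_Δ.map _
  rw [hΔ] at hu
  exact not_isUnit_zero hu

/-- **`W.IsDescendedFrobeniusMatrix M` from a `W`-intrinsic `ω`-column datum.** If the SAME `c, d ∈ ℚ₃` (`d ≠ 0`)
give `φ[ω_W] ≡ c[ω_W] + d[η_W]` on EVERY good model of `W`, and `([ω], φ[ω])` is independent modulo bounded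
denominators on every good model, then `M = !![c, ((a − c)c − 3)/d; d, a − c]` (with `a` the special-fibre trace
of any good model along any reduction map — an invariant of `W`) is THE descended Frobenius matrix: `det M = 3`,
`ClassesIndependent`, `IsPowerMapMatrix 9 (M²)`, `IsPowerMapMatrix 27 (M³)` on all good models, and `tr M = a`.
[cite: BerthelotOgus1983, Prop. (3.14)] [cite: Katz1981CrystallineDieudonne, Thm. 5.1.4, 5.3.3 and (6.1.1)] -/
theorem isDescendedFrobeniusMatrix_of_omegaColumn (𝓜 : W.NineGoodModel) (ρ : ONine →+* ZMod 3) {c d : ℚ_[3]}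
    (hd : d ≠ 0)
    (hω : ∀ 𝓜' : W.NineGoodModel, HasBoundedDenominators (expand 3 (by norm_num) 𝓜'.classOmega -
      PowerSeries.C (algebraMap ℚ_[3] KNine c) * 𝓜'.classOmega -
      PowerSeries.C (algebraMap ℚ_[3] KNine d) * 𝓜'.classEta))
    (hind : ∀ 𝓜' : W.NineGoodModel, ∀ x y : KNine, HasBoundedDenominators (PowerSeries.C x * 𝓜'.classOmega +
      PowerSeries.C y * expand 3 (by norm_num) 𝓜'.classOmega) → x = 0 ∧ y = 0) :
    W.IsDescendedFrobeniusMatrix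
        (!![c, (((𝓜.specialFibreTrace ρ : ℚ_[3]) - c) * c - 3) / d; d, (𝓜.specialFibreTrace ρ : ℚ_[3]) - c]) ∧
      (!![c, (((𝓜.specialFibreTrace ρ : ℚ_[3]) - c) * c - 3) / d; d, (𝓜.specialFibreTrace ρ : ℚ_[3]) - c] :
        Matrix (Fin 2) (Fin 2) ℚ_[3]).trace = (𝓜.specialFibreTrace ρ : ℚ_[3]) := by
  haveI := isElliptic_of_nineGoodModel 𝓜
  obtain ⟨hdet, htr, -⟩ := det_trace_of_omegaColumn (𝓜.specialFibreTrace ρ : ℚ_[3]) c d hd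
  refine ⟨⟨hdet, ⟨𝓜⟩, fun 𝓜' => ⟨classesIndependent_of_omegaColumn 𝓜' hd (hω 𝓜') (hind 𝓜'), ?_⟩⟩, htr⟩
  -- the trace is the same on every good model
  have ha : (𝓜.specialFibreTrace ρ : ℚ_[3]) = (𝓜'.specialFibreTrace ρ : ℚ_[3]) := by
    rw [specialFibreTrace_eq_of_nineGoodModel 𝓜 𝓜' ρ]
  rw [ha]
  exact isPowerMapMatrix_nine_twentySeven_of_omegaColumn 𝓜' ρ hd (hω 𝓜')

/-- **THE NAMED FACT FROM THE `ω`-COLUMN TRANSFER.** `WeierstrassCurve.isDescendedFrobeniusMatrix_exists` follows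
from: for every `W` with a good model over `𝓞` whose special fibre is supersingular, there are `c, d ∈ ℚ₃`, `d ≠ 0`,
such that on EVERY good model of `W` the Néron classes satisfy `φ[ω] ≡ c[ω] + d[η]` (`φ = (z ↦ z³)^*`) and `([ω], φ[ω])`
is independent, modulo bounded denominators. (The Frobenius structure of the `ω`-plane — `φ² − aφ + 3 = 0`, `det = 3`,
`tr = a`, the descent of `M` to `ℚ₃` GIVEN `c, d ∈ ℚ₃` — is kernel, parts 2–3; what is cited is only the position of
the second Néron class and the rank: Katz 1981 Thm. 5.3.3/5.7.2, Berthelot–Ogus (3.14).)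
[cite: Katz1981CrystallineDieudonne, Thm. 5.3.3 and Thm. 5.7.2] [cite: BerthelotOgus1983, Thm. (2.4) and Prop. (3.14)] -/
theorem isDescendedFrobeniusMatrix_exists_of_omegaColumnTransfer
    (H : ∀ (W : WeierstrassCurve ℚ) (𝓜 : W.NineGoodModel) (ρ : ONine →+* ZMod 3),
      (3 : ℤ) ∣ 𝓜.specialFibreTrace ρ →
        ∃ c d : ℚ_[3], d ≠ 0 ∧
          (∀ 𝓜' : W.NineGoodModel, HasBoundedDenominators (expand 3 (by norm_num) 𝓜'.classOmega -
            PowerSeries.C (algebraMap ℚ_[3] KNine c) * 𝓜'.classOmega -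
            PowerSeries.C (algebraMap ℚ_[3] KNine d) * 𝓜'.classEta)) ∧
          (∀ 𝓜' : W.NineGoodModel, ∀ x y : KNine, HasBoundedDenominators (PowerSeries.C x * 𝓜'.classOmega +
            PowerSeries.C y * expand 3 (by norm_num) 𝓜'.classOmega) → x = 0 ∧ y = 0)) :
    WeierstrassCurve.isDescendedFrobeniusMatrix_exists := by
  intro W 𝓜 ρ hss
  obtain ⟨c, d, hd, hω, hind⟩ := H W 𝓜 ρ hss
  exact ⟨_, isDescendedFrobeniusMatrix_of_omegaColumn 𝓜 ρ hd hω hind⟩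

end Summit.BirchSwinnertonDyer.BirchSwinnertonDyer.Theorems.NineDescendedFrobeniusOfOmegaColumn

end
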